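import Summits.QuantumFields.BalabanUV.Beta.CombHId2W2SymSwap
import Summits.QuantumFields.BalabanUV.Beta.CombHId2Record

/-!
# `BalabanUV.Beta.CombHId2W2Record` — binder row D1 (OWNER an2), (J-a) dictionary, (C2) at ORDER 2 AT THE (III′) RECORD, PART TWO CLOSED: **THE LEVEL-`j`
# `W` SLOT OF THE COMB-CHART LITERAL, BOUND THE DOOR's WAY, IS `W2SymOfK` OVER THE PERIODISED LEVEL-`j` TABLES — AND THE LEVEL-`(j+1)` SECOND-ORDER TABLE,
# BOUND THE DOOR's WAY, IS THE `T2RecOf` SUCCESSOR CLAUSE OVER THE PERIODISED LEVEL-`j` DATA** (the dictionary closes on itself down the levels)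

WHY.  `CombHId2Record.dper_tsum_T2comb_succ` split `dper M′ (x z ↦ Σ'_n T2_{j+1} b (b′+M′∘n) x z)` into `(cE₂·wV4 (j+1)) • e4OfKW Lc (GcombSh Lc j) S^per_j M^per_j W^{per,cs}_j b b′`
`+ (cB·wB2 (j+1)) •` the border term, with the OPAQUE periodised `W` slot `W^{per,cs}_j b b′ := dper M (x z ↦ Σ'_n WcombOf … j b (b′+M′∘n) x z)`.  At the record
`WcombOf … j = W2SymOfK (GcombSh Lc j) Lc (SpureCombOf … j) (tabs.M j) (T2_j) (M2Of mixFF j)` (`RecursiveWSlot.WrecOf_eq`), and `CombHId2W2SymSwap.dper_tsum_W2SymOfK_translate`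
pushes «copy-sum, then periodise» through `W2SymOfK` under the JOINT block covariances of its five slots — which the record supplies BY NAME: `shiftK_GcombSh` (TG),
`SpureCombOf_translate` (St), `tabs.hMt` (TM), `RecursiveWSlot.T2RecOf_translate` (the joint covariance of every `T2_j`), `BalabanStepW2.M2Of_translate tabs.hmixt` (Tmix);
localisation by `decays_GcombSh`, `locStencil_SpureCombOf`, `tabs.hM`, `RecursiveWSlot.T2RecOf_loc`, `BalabanStepW2.locStencilFM_M2Of tabs.hmix`.
WHAT ([folklore]; 0 `def`, 0 cited fact, 0 `def … : Prop`, 0 sorry; `S^per_j κ u := dper M (SpureCombOf … j κ u)`, `M^per_j ρ w := dper M (tabs.M j ρ w)`,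
`T2^{per,csf}_j κ u κ′ u′ := dper M (x z ↦ Σ'_n T2_j κ u κ′ (u′+M∘n) x z)`, `M2^{per,cs}_j κ u ρ w := dper M (x z ↦ Σ'_n M2Of mixFF j κ u ρ (w+M′∘n) x z)`, `M = Lc·M′`):
§1 record letters `exists_locStencil₂_T2comb (j)`, `T2comb_translate (j)`, `exists_locStencilFM_M2comb (j)`; §2 **`dper_tsum_WcombOf (hM) (j) (μ y ν y′)`**:
`dper M (x z a c ↦ Σ'_n WcombOf … j μ y ν (translate M′ y′ n) x z a c) = W2SymOfK (GcombSh Lc j) Lc S^per_j M^per_j T2^{per,csf}_j M2^{per,cs}_j μ y ν y′`, `WcombOf_per_cs_eq` (the same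
as an equality of bond families); §3 **`dper_tsum_T2comb_succ_read (hM) (j) (μ y ν y′)`**: `dper M′ (x z ↦ Σ'_n T2_{j+1} μ y ν (translate M′ y′ n) x z)
= (cE₂·wV4 (j+1)) • e4OfKW Lc (GcombSh Lc j) S^per_j M^per_j (W2SymOfK (GcombSh Lc j) Lc S^per_j M^per_j T2^{per,csf}_j M2^{per,cs}_j) μ y ν y′ + (cB·wB2 (j+1)) • dper M′ (x z ↦ Σ'_n vh₂S μ y ν (translate M′ y′ n) x z)`
— literally `T2RecOf_succ`'s clause over the data `(GcombSh Lc j, S^per_j, M^per_j, T2^{per,csf}_j, M2^{per,cs}_j)` with the border copy-summed; ONE hypothesis `hM`.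
NOT HERE: PART THREE (the door's `hId₂` polynomial in these words on the coarse torus — `perF` of §3, leaf-05's `V₁ ∕ W₁ ∕ X` form), the `d + 1 = 4` literal, any estimate;
nothing of Bałaban's asserted; `D1Tel` ∕ `D1Rep` OPEN; NOT (T-ID), NOT (J-a) complete, NOT D1, NEVER «G-an2-4 closed», NOT BetaPertH, NOT continuum, NOT Clay.

HONEST DEPENDENCY (page 1, mandatory): continuum YM on T⁴ ⇐ BetaPertH ∧ nine spine estimates (0/9 proved); BetaPertH ⇐ (D1) ∧ (D4) ∧ CAP+tail;
G-an2-4 gates asym, D1 and NE2/3/4.  HONEST FRAMING (cell contract, verbatim): «discharging `BetaPertH` makes Bałaban's UV stability UNCONDITIONAL —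
a real constructive-QFT result; it is NOT the continuum limit and NOT the Clay problem.»  ABSOLUTE RULE (cell charter, verbatim): «No internally-minted
statement may enter as a cited fact. Every hypothesis is either kernel-proved in this package or a verbatim quotation of a PUBLISHED theorem with page
reference. The manuscript(s) under audit are NOT citable for their own disputed steps — they are the thing under adjudication; programme-internal
(2001/route/tribunal) claims are never citable.»  Row D1 OWNER an2 (b2b-balaban-beta-an2) gen 44, 2026-08-23; over `CombHId2W2SymSwap`, `CombHId2Record`,
`CombChartStepJets`, `RecursiveWSlot`, `BalabanStepW2` BY NAME.  No existing file touched.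
-/

noncomputable section

open scoped BigOperators

namespace Summit.QuantumFields.BalabanUV.Beta.CombHId2W2Record

open Literature.MathematicalPhysics.QuantumFieldTheory.Balaban1983to89
open Literature.MathematicalPhysics.QuantumFieldTheory.Balaban1983to89.Beta
open B4TorusKernel.MultiPeriod (translate translate_apply)
open ExpKernelCalculus (MKer Decays BiLoc VertexFamily VertexFamily₂ comp shiftK)
open AffineAveraging (Site)
open OneStepResolventKernel (Fib LocStencil)
open BalabanCompositeJets (LocStencil₂)
open BalabanStepW2 (wV4 wB2 M2Of M2Of_translate locStencilFM_M2Of wM2)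
open SecondOrderResponse (W2SymOfK LocStencilFM)
open Summit.QuantumFields.BalabanUV.Beta.SpineRooted (e4OfKW T2RecOf WrecOf WrecOf_eq T2RecOf_loc T2RecOf_translate)
open Summit.QuantumFields.BalabanUV.Beta.AxialDressingRooted (one_le_of_neZero)
open Summit.QuantumFields.BalabanUV.Beta.FP.KernelPeriodisationFibLoc (dper)
open Summit.QuantumFields.BalabanUV.Beta.SymmetrisedStepJets (SymTables)
open Summit.QuantumFields.BalabanUV.Beta.CombChartStepJets (GcombSh SpureCombOf WcombOf SpureCombOf_translate locStencil_SpureCombOf decays_GcombSh shiftK_GcombSh)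
open Summit.QuantumFields.BalabanUV.Beta.CombHId2W2SymSwap (dper_tsum_W2SymOfK_translate)
open Summit.QuantumFields.BalabanUV.Beta.CombHId2Record (dper_tsum_T2comb_succ)

variable {d : ℕ} (M : Fin (d + 1) → ℕ) [∀ μ, NeZero (M μ)]
variable {Lc : ℕ} [NeZero Lc] {M' : Fin (d + 1) → ℕ} (tabs : SymTables d Lc) (cE cVH cΛ cE₂ cB : ℝ) (T : Fin 4 → Fin 4 → Fin 4 → Fin 4 → ℝ)

/-! ## §1 The record's letters for the two second-order slots -/

section Letters

omit [∀ μ, NeZero (M μ)] in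
/-- [folklore] (L2) at the record: every level-`j` second-order table `T2_j` of the comb-chart literal is a `LocStencil₂` family (`RecursiveWSlot.T2RecOf_loc` fed
(DG) `decays_GcombSh`, (LS♭) `locStencil_SpureCombOf`, (LM) `tabs.hM`, (LB) `tabs.hB`, (Lmix) `tabs.hmix`). -/
theorem exists_locStencil₂_T2comb (j : ℕ) :
    ∃ C δ : ℝ, 0 < δ ∧ LocStencil₂ (T2RecOf d Lc (GcombSh Lc) (SpureCombOf tabs cE cVH cΛ) tabs.M cE₂ cB T tabs.vh₂S tabs.mixFF j) C δ :=
  T2RecOf_loc cE₂ cB T tabs.vh₂S tabs.mixFF (one_le_of_neZero Lc) (decays_GcombSh (d := d) Lc) (locStencil_SpureCombOf tabs cE cVH cΛ) tabs.hM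
    tabs.hB tabs.hmix j

omit [∀ μ, NeZero (M μ)] in
/-- [folklore] (T2t) at the record: the JOINT block covariance of every `T2_j` (`RecursiveWSlot.T2RecOf_translate` fed (TG) `shiftK_GcombSh`, (St) `SpureCombOf_translate`,
(TM) `tabs.hMt`, (TB) `tabs.hBt`, (Tmix) `tabs.hmixt`). -/
theorem T2comb_translate (j : ℕ) (κ : Fin (d + 1)) (u : Site (d + 1)) (κ' : Fin (d + 1)) (u' t : Site (d + 1)) :
    T2RecOf d Lc (GcombSh Lc) (SpureCombOf tabs cE cVH cΛ) tabs.M cE₂ cB T tabs.vh₂S tabs.mixFF j κ (u + (Lc : ℤ) • t) κ' (u' + (Lc : ℤ) • t)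
      = shiftK (-((Lc : ℤ) • t)) (T2RecOf d Lc (GcombSh Lc) (SpureCombOf tabs cE cVH cΛ) tabs.M cE₂ cB T tabs.vh₂S tabs.mixFF j κ u κ' u') :=
  T2RecOf_translate cE₂ cB T (shiftK_GcombSh (d := d) Lc) (SpureCombOf_translate tabs cE cVH cΛ) tabs.hMt tabs.hBt tabs.hmixt j κ u κ' u' t

omit [∀ μ, NeZero (M μ)] [NeZero Lc] in
/-- [folklore] (Lmix₂) at the record: the weighted mixed table `M2Of mixFF j` is a `LocStencilFM` family (`BalabanStepW2.locStencilFM_M2Of tabs.hmix`). -/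
theorem exists_locStencilFM_M2comb (j : ℕ) : ∃ C δ : ℝ, 0 < δ ∧ LocStencilFM Lc (M2Of d Lc tabs.mixFF j) C δ := by
  obtain ⟨C, δ, hδ, h⟩ := tabs.hmix
  exact ⟨_, δ, hδ, locStencilFM_M2Of h j⟩

end Letters

/-! ## §2 The `W` slot of the record, bound the door's way, READ -/

section WSlot

/-- [folklore] **THE LEVEL-`j` `W` SLOT OF THE COMB-CHART LITERAL, COPY-SUMMED IN THE SECOND BOND AND PERIODISED, IS `W2SymOfK` OVER THE PERIODISED LEVEL-`j`
TABLES** (`M = Lc·M′`): `dper M (x z a c ↦ Σ'_n WcombOf … j μ y ν (translate M′ y′ n) x z a c) = W2SymOfK (GcombSh Lc j) Lc S^per_j M^per_j T2^{per,csf}_j M2^{per,cs}_j μ y ν y′`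
— `CombHId2W2SymSwap.dper_tsum_W2SymOfK_translate` with every socket discharged by the record's letters BY NAME. -/
theorem dper_tsum_WcombOf (hM : ∀ i, M i = Lc * M' i) (j : ℕ) (μ : Fin (d + 1)) (y : Site (d + 1)) (ν : Fin (d + 1)) (y' : Site (d + 1)) :
    dper M (fun x z a c => ∑' n : Site (d + 1), WcombOf tabs cE cVH cΛ cE₂ cB T j μ y ν (translate M' y' n) x z a c)
      = W2SymOfK (GcombSh (d := d) Lc j) Lc (fun κ u => dper M (SpureCombOf tabs cE cVH cΛ j κ u)) (fun ρ w => dper M (tabs.M j ρ w))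
          (fun κ u κ' u' => dper M (fun x z a c => ∑' n : Site (d + 1),
            T2RecOf d Lc (GcombSh Lc) (SpureCombOf tabs cE cVH cΛ) tabs.M cE₂ cB T tabs.vh₂S tabs.mixFF j κ u κ' (translate M u' n) x z a c))
          (fun κ u ρ w => dper M (fun x z a c => ∑' n : Site (d + 1), M2Of d Lc tabs.mixFF j κ u ρ (translate M' w n) x z a c)) μ y ν y' := by
  obtain ⟨δG, CG, hδG, hCG, hG⟩ := decays_GcombSh (d := d) (Lc := Lc) j
  obtain ⟨CS, δS, hδS, hS⟩ := locStencil_SpureCombOf tabs cE cVH cΛ j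
  obtain ⟨CM, δM, hδM, hMloc⟩ := tabs.hM j
  obtain ⟨C₂, δ₂, hδ₂, hS₂⟩ := exists_locStencil₂_T2comb tabs cE cVH cΛ cE₂ cB T j
  obtain ⟨Cm, δm, hδm, hM₂⟩ := exists_locStencilFM_M2comb tabs j
  have h := dper_tsum_W2SymOfK_translate M hM (shiftK_GcombSh (d := d) Lc j) hG hCG hδG (SpureCombOf_translate tabs cE cVH cΛ j) hS hδS
    (tabs.hMt j) hMloc hδM (T2comb_translate tabs cE cVH cΛ cE₂ cB T j) hS₂ hδ₂ (M2Of_translate (Lc := Lc) tabs.hmixt j) hM₂ hδm μ y ν y'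
  simpa only [WcombOf, WrecOf_eq] using h

/-- [folklore] The same as an equality of BOND FAMILIES: `(b b′ ↦ dper M (x z ↦ Σ'_n WcombOf … j b (b′+M′∘n) x z)) = W2SymOfK (GcombSh Lc j) Lc S^per_j M^per_j T2^{per,csf}_j M2^{per,cs}_j`. -/
theorem WcombOf_per_cs_eq (hM : ∀ i, M i = Lc * M' i) (j : ℕ) :
    (fun μ y ν y' => dper M (fun x z a c => ∑' n : Site (d + 1), WcombOf tabs cE cVH cΛ cE₂ cB T j μ y ν (translate M' y' n) x z a c))
      = W2SymOfK (GcombSh (d := d) Lc j) Lc (fun κ u => dper M (SpureCombOf tabs cE cVH cΛ j κ u)) (fun ρ w => dper M (tabs.M j ρ w))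
          (fun κ u κ' u' => dper M (fun x z a c => ∑' n : Site (d + 1),
            T2RecOf d Lc (GcombSh Lc) (SpureCombOf tabs cE cVH cΛ) tabs.M cE₂ cB T tabs.vh₂S tabs.mixFF j κ u κ' (translate M u' n) x z a c))
          (fun κ u ρ w => dper M (fun x z a c => ∑' n : Site (d + 1), M2Of d Lc tabs.mixFF j κ u ρ (translate M' w n) x z a c)) := by
  funext μ y ν y'
  exact dper_tsum_WcombOf M tabs cE cVH cΛ cE₂ cB T hM j μ y ν y'

end WSlot

/-! ## §3 The level-`(j+1)` second-order table, bound the door's way, READ -/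

section Read

variable [∀ μ, NeZero (M' μ)]

/-- [folklore] **THE DICTIONARY CLOSES ON ITSELF DOWN THE LEVELS**: `dper M′ (x z ↦ Σ'_n T2_{j+1} μ y ν (translate M′ y′ n) x z)
= (cE₂·wV4 (j+1)) • e4OfKW Lc (GcombSh Lc j) S^per_j M^per_j (W2SymOfK (GcombSh Lc j) Lc S^per_j M^per_j T2^{per,csf}_j M2^{per,cs}_j) μ y ν y′ + (cB·wB2 (j+1)) • dper M′ (x z ↦ Σ'_n vh₂S μ y ν (translate M′ y′ n) x z)`
— `RecursiveWSlot.T2RecOf_succ`'s clause over the periodised level-`j` data, the border copy-summed (`CombHId2Record.dper_tsum_T2comb_succ` + §2). ONE hypothesis `hM`. -/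
theorem dper_tsum_T2comb_succ_read (hM : ∀ i, M i = Lc * M' i) (j : ℕ) (μ : Fin (d + 1)) (y : Site (d + 1)) (ν : Fin (d + 1)) (y' : Site (d + 1)) :
    dper M' (fun x z a b => ∑' n, T2RecOf d Lc (GcombSh Lc) (SpureCombOf tabs cE cVH cΛ) tabs.M cE₂ cB T tabs.vh₂S tabs.mixFF (j + 1) μ y ν
        (translate M' y' n) x z a b)
      = (cE₂ * wV4 d Lc (j + 1)) • e4OfKW Lc (GcombSh (d := d) Lc j) (fun κ u => dper M (SpureCombOf tabs cE cVH cΛ j κ u))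
            (fun ρ w => dper M (tabs.M j ρ w))
            (W2SymOfK (GcombSh (d := d) Lc j) Lc (fun κ u => dper M (SpureCombOf tabs cE cVH cΛ j κ u)) (fun ρ w => dper M (tabs.M j ρ w))
              (fun κ u κ' u' => dper M (fun x z a c => ∑' n : Site (d + 1),
                T2RecOf d Lc (GcombSh Lc) (SpureCombOf tabs cE cVH cΛ) tabs.M cE₂ cB T tabs.vh₂S tabs.mixFF j κ u κ' (translate M u' n) x z a c))
              (fun κ u ρ w => dper M (fun x z a c => ∑' n : Site (d + 1), M2Of d Lc tabs.mixFF j κ u ρ (translate M' w n) x z a c))) μ y ν y'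
        + (cB * wB2 d Lc (j + 1)) • dper M' (fun x z a b => ∑' n, tabs.vh₂S μ y ν (translate M' y' n) x z a b) := by
  rw [dper_tsum_T2comb_succ M tabs cE cVH cΛ cE₂ cB T hM j μ y ν y', WcombOf_per_cs_eq M tabs cE cVH cΛ cE₂ cB T hM j]

end Read

end Summit.QuantumFields.BalabanUV.Beta.CombHId2W2Record

end
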